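import Literature.MathematicalPhysics.QuantumFieldTheory.WilsonFinTorusTwistedPartition
import Summits.QuantumFields.YangMills.Cruxes.IR.Lines.flux_purity_split
import Summits.QuantumFields.YangMills.Theorems.BalabanLadderIRTwistCostOfPurity
import HarnessLib

/-!
# ANOMALY SHEET g3 (ym-ir-idea-29, lens «anomaly»): the composition `SinglePlaneSufficesColdBoxes` of sheet g2 is PROVED

Sheet g2 (`ANOMALY_SHEET_ym_ir_idea_29_g2`, commit 2379b634ade2) typed the re-typed R2 of the crux idea
`orthogonal-twist-supermodularity` only as a `Prop`:
`SinglePlaneSufficesColdBoxes : Prop := TwistFKGColdBoxes → ConfinedSinglePlaneTwistSC → ConfinedTemporalTwistSC`.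
This sheet PROVES it (`singlePlaneSufficesColdBoxes`), i.e. the card's bookkeeping claim is now kernel-checked:
cold-box FKG of orthogonal temporal twists (two instances) + ε-invisibility of every SINGLE-plane central twist
⇒ idea-10's `F = FluxPuritySplit.ConfinedTemporalTwistSC` (ε-invisibility of EVERY central temporal twist).

Bookkeeping, verbatim the g2 docstring: at `β ≥ max β₁ 0`, `L ≥ max (max L₀ L₁) 8`, `t ∈ {⌊L/4⌋, 2⌊L/4⌋}` (so `t ≥ 2`):
lower side `Z(z₀,z₁,z₂)·Z ≥ Z(z₀,z₁)·Z(z₂)`, `Z(z₀,z₁)·Z ≥ Z(z₀)·Z(z₁)`, `Z(zᵢ) ≥ (1−ε')Z` with `ε' = min (ε/3) (1/2)`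
⇒ `Z(z) ≥ (1−ε')³ Z ≥ (1−3ε') Z ≥ (1−ε) Z`; upper side `Z(z) ≤ Z` BY NAME from the tree
(`Cruxes.IR.TwistCost.twistedPartition_le`, 't Hooft (2.20) via the transfer matrix: continuous unitary `ρ`, `β ≥ 0`,
time `m + 2`); `z 3` is never read (`twistedColdZ_congr_of_ne_three`).  Second countability of `G` from the faithful
continuous `LatticeRep` (as in `TwistCost.fluxExitAt_of_coldExitAt`).

HONEST LABEL: bookkeeping only — no Yang–Mills content; `TwistFKGColdBoxes` and `ConfinedSinglePlaneTwistSC` stay OPEN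
(GUIDANCE-level evidence only: TABLE-E2-Q3 rows C1∕C3, E29-FEMTO); `IRcof` ∕ `IR` ∕ `PXcof` ∕ `N_cof` stay 0∕1; R4 closes
only the conditional finite-𝕋⁴ rung `BalabanLadder.UV`; the Yang–Mills mass gap (Clay) is NOT proved by any of this.
NOT an item, NOT a line, nothing registered; no `sorry`; standard axioms.  The g2 sheet is not an importable build target on
the farm (`remote: unbuilt`), so its three `def`s `TwistFKGColdBoxes`, `ConfinedSinglePlaneTwistSC`, `SinglePlaneSufficesColdBoxes`
(and the `rfl` bridge `twistedColdZ_eq`) are repeated here VERBATIM (same names, namespace `…AnomalySheetG3`); under an import of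
g2 the proved statement is g2's by `Iff.rfl`.
-/

set_option autoImplicit false

namespace Summit.QuantumFields.YangMills.Cruxes.IRcof.AnomalySheetG3

open MeasureTheory Function Literature.MathematicalPhysics.QuantumFieldTheory
open Summit.QuantumFields.YangMills.Cruxes.IR.FluxPuritySplit (siteCoord twistFactor twistedColdZ twistedColdZ_one
  ConfinedTemporalTwistSC)

/-! ## The three g2 `def`s, VERBATIM (g2 = `Cruxes/IRcof/ANOMALY_SHEET_ym_ir_idea_29_g2.lean`, commit 2379b634ade2) -/

/-- The cold-box twisted partition function of the `IR` crux lines IS the Literature one (definitional). [g2 verbatim] -/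
theorem twistedColdZ_eq {G : Type} [Group G] [TopologicalSpace G] [IsTopologicalGroup G] [CompactSpace G]
    [MeasurableSpace G] [BorelSpace G] {n : ℕ} (ρ : G →* Matrix (Fin n) (Fin n) ℂ) (β : ℝ) (z : Fin 4 → G)
    (L t : ℕ) : twistedColdZ ρ β z L t = wilsonFinTorusTwistedPartition ρ β z L L L t := rfl

/-- **FKG lattice condition of the temporally twisted partition function in the cold 4:1 boxes of a simply-connected
compact simple `G`, beyond a `β`-dependent size** — two clauses: planes `{0}` vs `{1}`, and planes `{0,1}` vs `{2}`.
OPEN (GUIDANCE: TABLE-E2-Q3 j313871 rows C1 `+13.1σ`, C3 `+6.1σ`; E29-FEMTO j322914 F1∕F3 `+6.5σ`∕`+8.3σ`). [g2 verbatim] -/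
def TwistFKGColdBoxes : Prop :=
  ∀ (G : Type) [Group G] [TopologicalSpace G] [IsTopologicalGroup G] [CompactSpace G],
    IsCompactSimpleLieGroup G → SimplyConnectedSpace G →
    letI : MeasurableSpace G := borel G
    haveI : BorelSpace G := ⟨rfl⟩
    ∀ r : LatticeRep G, ∀ β : ℝ, 0 ≤ β → ∃ L₀ : ℕ, ∀ L : ℕ, L₀ ≤ L →
      ∀ c c' c'' : G, c ∈ Subgroup.center G → c' ∈ Subgroup.center G → c'' ∈ Subgroup.center G →
      ∀ t : ℕ, (t = L / 4 ∨ t = 2 * (L / 4)) →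
        twistedColdZ r.ρ β (Function.update (1 : Fin 4 → G) 0 c) L t *
            twistedColdZ r.ρ β (Function.update (1 : Fin 4 → G) 1 c') L t ≤
          twistedColdZ r.ρ β (Function.update (Function.update (1 : Fin 4 → G) 0 c) 1 c') L t *
            twistedColdZ r.ρ β (1 : Fin 4 → G) L t ∧
        twistedColdZ r.ρ β (Function.update (Function.update (1 : Fin 4 → G) 0 c) 1 c') L t *
            twistedColdZ r.ρ β (Function.update (1 : Fin 4 → G) 2 c'') L t ≤
          twistedColdZ r.ρ β (Function.update (Function.update (Function.update (1 : Fin 4 → G) 0 c) 1 c') 2 c'') L t *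
            twistedColdZ r.ρ β (1 : Fin 4 → G) L t

/-- F restricted to ONE temporal plane class: every SINGLE-plane central twist `update 1 μ c` is `ε`-invisible in the
cold 4:1 boxes.  OPEN. [g2 ∕ g0 verbatim] -/
def ConfinedSinglePlaneTwistSC : Prop :=
  ∀ (G : Type) [Group G] [TopologicalSpace G] [IsTopologicalGroup G] [CompactSpace G],
    IsCompactSimpleLieGroup G → SimplyConnectedSpace G →
    letI : MeasurableSpace G := borel G
    haveI : BorelSpace G := ⟨rfl⟩
    ∀ r : LatticeRep G, ∀ ε : ℝ, 0 < ε → ∃ β₁ : ℝ, ∀ β : ℝ, β₁ ≤ β → ∃ L₁ : ℕ, ∀ L : ℕ, L₁ ≤ L →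
      ∀ (μ : Fin 4) (c : G), c ∈ Subgroup.center G → ∀ t : ℕ, (t = L / 4 ∨ t = 2 * (L / 4)) →
        |twistedColdZ r.ρ β (Function.update 1 μ c) L t - wilsonFinTorusPartition r.ρ β L L L t| ≤
          ε * wilsonFinTorusPartition r.ρ β L L L t

/-- R2 re-typed, BY NAME: cold-box FKG plus one-plane confinement of temporal twist give idea-10's `F`. [g2 verbatim;
PROVED below as `singlePlaneSufficesColdBoxes`] -/
def SinglePlaneSufficesColdBoxes : Prop :=
  TwistFKGColdBoxes → ConfinedSinglePlaneTwistSC → ConfinedTemporalTwistSC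

/-! ## The proof -/

/-- The twist insertion on a plaquette `(μ, ν)` with `μ < ν` never reads `z 3`. -/
theorem twistFactor_congr_of_ne_three {G : Type} [Group G] {z z' : Fin 4 → G}
    (h : ∀ μ : Fin 4, μ ≠ 3 → z μ = z' μ) {n₀ n₁ n₂ n₃ : ℕ} (x : FinTorusSite n₀ n₁ n₂ n₃) {μ ν : Fin 4}
    (hμν : μ < ν) : twistFactor z x μ ν = twistFactor z' x μ ν := by
  unfold twistFactor
  by_cases hc : ν = 3 ∧ siteCoord x 3 = 0 ∧ siteCoord x μ = 0
  · rw [if_pos hc, if_pos hc]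
    refine h μ ?_
    intro hμ
    rw [hμ, hc.1] at hμν
    exact lt_irrefl _ hμν
  · rw [if_neg hc, if_neg hc]

/-- **`z 3` is never read**: two twists agreeing on the three temporal planes `0, 1, 2` have the same cold-box partition
function. -/
theorem twistedColdZ_congr_of_ne_three {G : Type} [Group G] [TopologicalSpace G] [IsTopologicalGroup G]
    [CompactSpace G] [MeasurableSpace G] [BorelSpace G] {n : ℕ} (ρ : G →* Matrix (Fin n) (Fin n) ℂ) (β : ℝ)
    {z z' : Fin 4 → G} (h : ∀ μ : Fin 4, μ ≠ 3 → z μ = z' μ) (L t : ℕ) :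
    twistedColdZ ρ β z L t = twistedColdZ ρ β z' L t := by
  have hf : ∀ (x : FinTorusSite L L L t) (q : {q : Fin 4 × Fin 4 // q.1 < q.2}),
      twistFactor z x q.1.1 q.1.2 = twistFactor z' x q.1.1 q.1.2 := fun x q =>
    twistFactor_congr_of_ne_three h x q.2
  unfold twistedColdZ
  simp only [hf]

/-- The three-plane re-assembly of a twist from its read entries. -/
theorem update_three_eq {G : Type} (z : Fin 4 → G) (one : Fin 4 → G) :
    ∀ μ : Fin 4, μ ≠ 3 →
      z μ = update (update (update one 0 (z 0)) 1 (z 1)) 2 (z 2) μ := by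
  intro μ hμ
  fin_cases μ <;> simp_all [update]

/-- **R2 re-typed, PROVED**: cold-box FKG of orthogonal temporal twists plus ε-invisibility of every single-plane
central twist give idea-10's `F` (`FluxPuritySplit.ConfinedTemporalTwistSC`).  Pure bookkeeping over the tree's
`twistedPartition_le` (`Z^{(z)} ≤ Z`) and `wilsonFinTorusPartition_pos`. -/
theorem singlePlaneSufficesColdBoxes : SinglePlaneSufficesColdBoxes := by
  intro hFKG hSP G _ _ _ _ hG hsc
  letI : MeasurableSpace G := borel G
  haveI : BorelSpace G := ⟨rfl⟩
  intro r ε hε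
  haveI : SecondCountableTopology G :=
    (r.continuous.isClosedEmbedding r.injective).isEmbedding.secondCountableTopology
  -- the single-plane tolerance
  obtain ⟨ε', hε'pos, hε'le, hε'le1⟩ : ∃ ε' : ℝ, 0 < ε' ∧ ε' ≤ ε / 3 ∧ ε' ≤ 1 / 2 :=
    ⟨min (ε / 3) (1 / 2), lt_min (by positivity) (by norm_num), min_le_left _ _, min_le_right _ _⟩
  obtain ⟨β₁, hβ₁⟩ := hSP G hG hsc r ε' hε'pos
  refine ⟨max β₁ 0, fun β hβ => ?_⟩
  have hβ0 : 0 ≤ β := (le_max_right _ _).trans hβ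
  obtain ⟨L₁, hL₁⟩ := hβ₁ β ((le_max_left _ _).trans hβ)
  obtain ⟨L₀, hL₀⟩ := hFKG G hG hsc r β hβ0
  refine ⟨max (max L₀ L₁) 8, fun L hL z hz t ht => ?_⟩
  have hL0 : L₀ ≤ L := ((le_max_left _ _).trans (le_max_left _ _)).trans hL
  have hL1 : L₁ ≤ L := ((le_max_right _ _).trans (le_max_left _ _)).trans hL
  have hL8 : 8 ≤ L := (le_max_right _ _).trans hL
  -- `t ≥ 2`
  obtain ⟨m, rfl⟩ : ∃ m : ℕ, t = m + 2 := ⟨t - 2, by rcases ht with h | h <;> omega⟩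
  have hZpos : 0 < wilsonFinTorusPartition r.ρ β L L L (m + 2) :=
    wilsonFinTorusPartition_pos r.continuous β L L L (m + 2)
  -- upper side BY NAME: `Z^{(z)} ≤ Z`
  have hup : twistedColdZ r.ρ β z L (m + 2) ≤ wilsonFinTorusPartition r.ρ β L L L (m + 2) := by
    rw [twistedColdZ_eq]
    exact IR.TwistCost.twistedPartition_le r.continuous r.mem_unitary hβ0 L L L m hz
  -- `z 3` is never read: pass to the re-assembled twist
  have hzeq : twistedColdZ r.ρ β z L (m + 2) =
      twistedColdZ r.ρ β (update (update (update 1 0 (z 0)) 1 (z 1)) 2 (z 2)) L (m + 2) :=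
    twistedColdZ_congr_of_ne_three r.ρ β (update_three_eq z 1) L (m + 2)
  -- single-plane lower bounds
  have hsp : ∀ μ : Fin 4, (1 - ε') * wilsonFinTorusPartition r.ρ β L L L (m + 2) ≤
      twistedColdZ r.ρ β (update 1 μ (z μ)) L (m + 2) := by
    intro μ
    have h := hL₁ L hL1 μ (z μ) (hz μ) (m + 2) ht
    rw [abs_sub_le_iff] at h
    linarith [h.2]
  -- the two FKG instances consumed
  obtain ⟨h01, h012⟩ := hL₀ L hL0 (z 0) (z 1) (z 2) (hz 0) (hz 1) (hz 2) (m + 2) ht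
  rw [twistedColdZ_one] at h01 h012
  have h1e : 0 ≤ 1 - ε' := by linarith
  have hk : 0 ≤ (1 - ε') * wilsonFinTorusPartition r.ρ β L L L (m + 2) := mul_nonneg h1e hZpos.le
  have hA := hsp 0
  have hB := hsp 1
  have hC := hsp 2
  -- two planes: `Z(z₀,z₁) ≥ (1−ε')² Z`
  have hAB : (1 - ε') * wilsonFinTorusPartition r.ρ β L L L (m + 2) *
      ((1 - ε') * wilsonFinTorusPartition r.ρ β L L L (m + 2)) ≤
      twistedColdZ r.ρ β (update 1 0 (z 0)) L (m + 2) * twistedColdZ r.ρ β (update 1 1 (z 1)) L (m + 2) :=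
    mul_le_mul hA hB hk (hk.trans hA)
  have hD : (1 - ε') ^ 2 * wilsonFinTorusPartition r.ρ β L L L (m + 2) ≤
      twistedColdZ r.ρ β (update (update 1 0 (z 0)) 1 (z 1)) L (m + 2) := by
    have h2 : (1 - ε') ^ 2 * wilsonFinTorusPartition r.ρ β L L L (m + 2) *
        wilsonFinTorusPartition r.ρ β L L L (m + 2) ≤
        twistedColdZ r.ρ β (update (update 1 0 (z 0)) 1 (z 1)) L (m + 2) *
          wilsonFinTorusPartition r.ρ β L L L (m + 2) := by
      nlinarith [hAB, h01]
    exact le_of_mul_le_mul_right h2 hZpos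
  -- three planes: `Z(z₀,z₁,z₂) ≥ (1−ε')³ Z`
  have hk2 : 0 ≤ (1 - ε') ^ 2 * wilsonFinTorusPartition r.ρ β L L L (m + 2) :=
    mul_nonneg (sq_nonneg _) hZpos.le
  have hDC : (1 - ε') ^ 2 * wilsonFinTorusPartition r.ρ β L L L (m + 2) *
      ((1 - ε') * wilsonFinTorusPartition r.ρ β L L L (m + 2)) ≤
      twistedColdZ r.ρ β (update (update 1 0 (z 0)) 1 (z 1)) L (m + 2) *
        twistedColdZ r.ρ β (update 1 2 (z 2)) L (m + 2) :=
    mul_le_mul hD hC hk (hk2.trans hD)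
  have hE : (1 - ε') ^ 3 * wilsonFinTorusPartition r.ρ β L L L (m + 2) ≤
      twistedColdZ r.ρ β (update (update (update 1 0 (z 0)) 1 (z 1)) 2 (z 2)) L (m + 2) := by
    have h3 : (1 - ε') ^ 3 * wilsonFinTorusPartition r.ρ β L L L (m + 2) *
        wilsonFinTorusPartition r.ρ β L L L (m + 2) ≤
        twistedColdZ r.ρ β (update (update (update 1 0 (z 0)) 1 (z 1)) 2 (z 2)) L (m + 2) *
          wilsonFinTorusPartition r.ρ β L L L (m + 2) := by
      nlinarith [hDC, h012]
    exact le_of_mul_le_mul_right h3 hZpos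
  -- `(1−ε')³ ≥ 1 − 3ε' ≥ 1 − ε`
  have hcube : 1 - ε ≤ (1 - ε') ^ 3 := by
    have hx : 0 ≤ ε' ^ 2 * (3 - ε') := mul_nonneg (sq_nonneg _) (by linarith)
    nlinarith [hx, hε'le]
  have hlow : (1 - ε) * wilsonFinTorusPartition r.ρ β L L L (m + 2) ≤ twistedColdZ r.ρ β z L (m + 2) := by
    rw [hzeq]
    exact (mul_le_mul_of_nonneg_right hcube hZpos.le).trans hE
  rw [abs_sub_le_iff]
  constructor
  · nlinarith [hup, hZpos, hε]
  · linarith [hlow]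

end Summit.QuantumFields.YangMills.Cruxes.IRcof.AnomalySheetG3
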